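import Literature.AlgebraicGeometry.Resolution.BaseTreeFinite
import Literature.AlgebraicGeometry.Resolution.QuadraticTransformsTransport
import HarnessLib

/-!
# The base tree of an ideal is invariant under field isomorphisms
# (Zariski–Samuel II, Appendix 5 — bookkeeping for Stacks Project Lemma 54.4.1 = Tag 0AHH)

Topic: `Literature/AlgebraicGeometry/Resolution`. Theorem-only file (sorry-free, no definitions, no
named facts), a brick toward the discharge of the named fact F-75c
`Stacks0BIC_embeddedResolutionCurvesInSurfaces_locus` (`EmbeddedResolutionCurvesInSurfaces.lean`). In
the principalization of an ideal sheaf on a regular surface by point blow-ups (Stacks Tag 0AHH) the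
termination measure is the number of members of the base trees `idealBaseTree R J`
(`BaseTreeFinite.lean`; Zariski–Samuel II, App. 5) of the local rings `R = 𝒪_{X,x} ⊆ K(X)`; after a
blow-up `X' → X` the local rings of `X'` are read in `K(X')`, and `K(X') ≅ K(X)`. This file transports
quadratic transforms, their iterates and the base tree of an ideal along an isomorphism of fields
`e : K ≃+* L` (the tree's `isQuadraticTransform_comap`, `QuadraticTransformsTransport.lean`, is the
pull-back along a field embedding):

* `isQuadraticTransform_map_equiv`, `reflTransGen_isQuadraticTransform_map_equiv_iff`;
* `isPrincipal_extIdeal_map_equiv_iff` — principality of `J S` versus `J' S'` for `S' = e(S)` and an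
  ideal `J'` of `e(R)` with the same image in `L` as `e(J)`;
* `ncard_idealBaseTree_map_equiv` — **`#idealBaseTree e(R) J' = #idealBaseTree R J`.**

AI-written; weaker than expert review. Not a statement of [Hironaka2017].

## References
* O. Zariski, P. Samuel, *Commutative Algebra* II (1960), Appendix 5. [ZariskiSamuel1960]
* The Stacks Project, Tag 0AHH (Lemma 54.4.1). [StacksProject]
-/

noncomputable section

namespace Literature.AlgebraicGeometry.Resolution

universe u

open IsLocalRing

variable {K L : Type u} [Field K] [Field L] (e : K ≃+* L)

/-! ## Quadratic transforms along a field isomorphism -/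

/-- Push-forward of a quadratic transform along a field isomorphism. [cite: ZariskiSamuel1960, Appendix 5] -/
theorem isQuadraticTransform_map_equiv {R R₁ : Subring K} (h : IsQuadraticTransform R R₁) :
    IsQuadraticTransform (R.map e.toRingHom) (R₁.map e.toRingHom) := by
  rw [RingEquiv.toRingHom_eq_coe, Subring.map_equiv_eq_comap_symm, Subring.map_equiv_eq_comap_symm,
    ← RingEquiv.toRingHom_eq_coe]
  exact isQuadraticTransform_comap (ι := e.symm.toRingHom)
    (fun z _ => ⟨e z, by simp⟩) h

/-- Pull-back of a quadratic transform along a field isomorphism. [cite: ZariskiSamuel1960, Appendix 5] -/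
theorem isQuadraticTransform_comap_equiv {R' R₁' : Subring L} (h : IsQuadraticTransform R' R₁') :
    IsQuadraticTransform (R'.comap e.toRingHom) (R₁'.comap e.toRingHom) :=
  isQuadraticTransform_comap (ι := e.toRingHom) (fun z _ => ⟨e.symm z, by simp⟩) h

/-- `(S.map e).comap e = S`. [folklore] -/
private theorem comap_map_equiv (S : Subring K) :
    (S.map e.toRingHom).comap e.toRingHom = S :=
  Subring.comap_map_eq_self_of_injective e.injective S

/-- `(T.comap e).map e = T`. [folklore] -/
private theorem map_comap_equiv (T : Subring L) :
    (T.comap e.toRingHom).map e.toRingHom = T :=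
  Subring.map_comap_eq_self (by intro z _; exact ⟨e.symm z, by simp⟩)

/-- Iterated quadratic transforms correspond under a field isomorphism.
[cite: ZariskiSamuel1960, Appendix 5] -/
theorem reflTransGen_isQuadraticTransform_map_equiv_iff {R S : Subring K} :
    Relation.ReflTransGen IsQuadraticTransform (R.map e.toRingHom) (S.map e.toRingHom) ↔
      Relation.ReflTransGen IsQuadraticTransform R S := by
  constructor
  · intro h
    -- pull back along `e`
    have key : ∀ T : Subring L, Relation.ReflTransGen IsQuadraticTransform (R.map e.toRingHom) T →
        Relation.ReflTransGen IsQuadraticTransform R (T.comap e.toRingHom) := by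
      intro T hT
      induction hT with
      | refl => rw [comap_map_equiv]
      | tail _ hq ih => exact ih.tail (isQuadraticTransform_comap_equiv e hq)
    have h' := key _ h
    rwa [comap_map_equiv] at h'
  · intro h
    induction h with
    | refl => exact Relation.ReflTransGen.refl
    | tail _ hq ih => exact ih.tail (isQuadraticTransform_map_equiv e hq)

/-! ## Extended ideals along a field isomorphism -/

/-- **Principality of the extended ideal is invariant**: for `R ≤ S ≤ K`, an ideal `J` of `R` and an
ideal `J'` of `e(R)` with the same image in `L` as `e(J)`, `J S` is principal iff `J' e(S)` is.
[cite: ZariskiSamuel1960, Appendix 5] -/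
theorem isPrincipal_extIdeal_map_equiv_iff {R S : Subring K} {J : Ideal R}
    {J' : Ideal (R.map e.toRingHom)}
    (hJJ' : ((↑) : R.map e.toRingHom → L) '' (J' : Set (R.map e.toRingHom)) =
      e '' (((↑) : R → K) '' (J : Set R))) :
    (extIdeal J' (S.map e.toRingHom)).IsPrincipal ↔ (extIdeal J S).IsPrincipal := by
  -- the ring isomorphism `ψ : S ≃ e(S)` maps the generating set of `J S` onto that of `J' e(S)`
  set ψ : S ≃+* S.map e.toRingHom := e.subringMap (s := S) with hψ
  have hψcoe : ∀ z : S, ((ψ z : S.map e.toRingHom) : L) = e (z : K) := fun _ => rfl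
  have hgen : (ψ : S → S.map e.toRingHom) '' {z : S | (z : K) ∈ ((↑) : R → K) '' (J : Set R)} =
      {t : S.map e.toRingHom | (t : L) ∈ ((↑) : R.map e.toRingHom → L) '' (J' : Set _)} := by
    ext t
    constructor
    · rintro ⟨z, hz, rfl⟩
      change ((ψ z : S.map e.toRingHom) : L) ∈ ((↑) : R.map e.toRingHom → L) '' (J' : Set _)
      rw [hJJ', hψcoe]
      exact ⟨(z : K), hz, rfl⟩
    · intro ht
      change (t : L) ∈ ((↑) : R.map e.toRingHom → L) '' (J' : Set _) at ht
      rw [hJJ'] at ht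
      obtain ⟨k, hk, hkt⟩ := ht
      refine ⟨ψ.symm t, ?_, ψ.apply_symm_apply t⟩
      change ((ψ.symm t : S) : K) ∈ ((↑) : R → K) '' (J : Set R)
      have h1 := hψcoe (ψ.symm t)
      rw [ψ.apply_symm_apply] at h1
      have h2 : ((ψ.symm t : S) : K) = k := e.injective (by rw [← h1, hkt])
      rw [h2]
      exact hk
  have hmap : (extIdeal J S).map ψ.toRingHom = extIdeal J' (S.map e.toRingHom) := by
    rw [extIdeal, extIdeal, Ideal.map_span]
    exact congrArg Ideal.span hgen
  constructor
  · intro h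
    have h2 : ((extIdeal J' (S.map e.toRingHom)).map ψ.symm.toRingHom).IsPrincipal :=
      h.map_ringHom ψ.symm.toRingHom
    rw [← hmap, Ideal.map_map] at h2
    have hid : ψ.symm.toRingHom.comp ψ.toRingHom = RingHom.id S :=
      RingHom.ext fun z => ψ.symm_apply_apply z
    rwa [hid, Ideal.map_id] at h2
  · intro h
    rw [← hmap]
    exact h.map_ringHom ψ.toRingHom

/-! ## The base tree along a field isomorphism -/

/-- **The base tree is transported by a field isomorphism**: with `J'` as above,
`idealBaseTree e(R) J' = e(idealBaseTree R J)`. [cite: ZariskiSamuel1960, Appendix 5] -/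
theorem idealBaseTree_map_equiv {R : Subring K} {J : Ideal R} {J' : Ideal (R.map e.toRingHom)}
    (hJJ' : ((↑) : R.map e.toRingHom → L) '' (J' : Set (R.map e.toRingHom)) =
      e '' (((↑) : R → K) '' (J : Set R))) :
    idealBaseTree (R.map e.toRingHom) J' =
      (fun S : Subring K => S.map e.toRingHom) '' idealBaseTree R J := by
  ext T
  simp only [Set.mem_image]
  constructor
  · rintro ⟨hT, hnp⟩
    refine ⟨T.comap e.toRingHom, ⟨?_, ?_⟩, map_comap_equiv e T⟩
    · rw [← reflTransGen_isQuadraticTransform_map_equiv_iff e, map_comap_equiv]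
      exact hT
    · rw [← isPrincipal_extIdeal_map_equiv_iff e hJJ', map_comap_equiv]
      exact hnp
  · rintro ⟨S, ⟨hS, hnp⟩, rfl⟩
    exact ⟨(reflTransGen_isQuadraticTransform_map_equiv_iff e).mpr hS,
      fun h => hnp ((isPrincipal_extIdeal_map_equiv_iff e hJJ').mp h)⟩

/-- **`#idealBaseTree e(R) J' = #idealBaseTree R J`** — the count of base points does not depend on
the field in which the local rings are read. [cite: ZariskiSamuel1960, Appendix 5] -/
theorem ncard_idealBaseTree_map_equiv {R : Subring K} {J : Ideal R} {J' : Ideal (R.map e.toRingHom)}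
    (hJJ' : ((↑) : R.map e.toRingHom → L) '' (J' : Set (R.map e.toRingHom)) =
      e '' (((↑) : R → K) '' (J : Set R))) :
    (idealBaseTree (R.map e.toRingHom) J').ncard = (idealBaseTree R J).ncard := by
  rw [idealBaseTree_map_equiv e hJJ']
  exact Set.ncard_image_of_injective _ fun S₁ S₂ h => by
    have := congrArg (fun T : Subring L => T.comap e.toRingHom) h
    simpa only [comap_map_equiv] using this

/-- Finiteness is transported too. [cite: ZariskiSamuel1960, Appendix 5] -/
theorem finite_idealBaseTree_map_equiv_iff {R : Subring K} {J : Ideal R}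
    {J' : Ideal (R.map e.toRingHom)}
    (hJJ' : ((↑) : R.map e.toRingHom → L) '' (J' : Set (R.map e.toRingHom)) =
      e '' (((↑) : R → K) '' (J : Set R))) :
    (idealBaseTree (R.map e.toRingHom) J').Finite ↔ (idealBaseTree R J).Finite := by
  rw [idealBaseTree_map_equiv e hJJ']
  exact Set.finite_image_iff (Set.injOn_of_injective (fun S₁ S₂ h => by
    have := congrArg (fun T : Subring L => T.comap e.toRingHom) h
    simpa only [comap_map_equiv] using this))

end Literature.AlgebraicGeometry.Resolution

end
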